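import Summits.NavierStokesRegularity.NavierStokesRegularity.Theorems.AxisTwistDoorAveragedConeLiouvilleNUWeakEnergyLimit
import Summits.NavierStokesRegularity.NavierStokesRegularity.Theorems.AxisTwistDoorAveragedConeLiouvilleNUDivFreeTransfer
import HarnessLib

/-!
# Route `AxisTwistDoor`, crux `AveragedConeLiouville` (stmt-NavierStokesRegularity-26889) — INPUT N4 / T1, piece W (N-W part 2),
# brick (b1): THE DRIFT TERM OF THE WEAK ENERGY IDENTITY IS TRANSFERRED ONTO THE TEST `Θ²`

T1 kit `kits/N4-T1-skeleton.lean` 118454bf17607d1e (pub/ns-inputs; W = `Sig.nu_weakEnergyIdentity → Sig.nu_standing_of_weak`).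
W1's energy identity carries the drift term `−∫∫_{[t₁,t₂]×ℝ³} η Θ² H′(V)⟪b,∇V⟫`; the energy class `NUEnergyClass` wants
`+∫∫ η H(V)⟪b,∇Θ²⟫` instead.  For the weak data of the typed fact (measurable bounded `b`, divergence free in `𝒟′`, `V` Lipschitz
on `W = ]0,T[ × B(0,1)`) the two agree:

* `nu_drift_transfer` — `∫∫_{[t₁,t₂]×ℝ³} η Θ² H′(V)⟪b,∇V⟫ + ∫∫_{[t₁,t₂]×ℝ³} η H(V)⟪b,∇Θ²⟫ = 0` for `0 < t₁ ≤ t₂ < T`, `η ∈ C¹`,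
  `H ∈ C²`, `Θ ∈ C¹_c` with `tsupport Θ ⊆ B(0,ρ₀)`, `ρ₀ < 1`.

Proof: the Lipschitz compactly supported test `w_h = H(g)Θ²·ηχ_h` (`g` the McShane extension of `V`, `χ_h` the slab plateau of
`exists_slab_cutoff`, admissibility `exists_lipschitzWith_test`) is divergence-tested by brick (a)
(`NU.integral_inner_gradient_eq_zero_of_lipschitz`); at Rademacher points `⟪b,∇ₓw_h⟫ = χ_h·(ηΘ²H′(V)⟪b,∇V⟫ + ηH(V)⟪b,∇Θ²⟫)`
(`inner_gradient_test_at`); `h → 0⁺` by `tendsto_integral_cutoff` / `tendsto_slab_cutoff_indicator` and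
`setIntegral_Icc_univ_eq_cutoff` (bricks of ns-in-ser-b g2's W1 chain, reused by name).

No NS statement is touched; T1 is an INPUT; item 26889 and the summit are not affected.
`--supports stmt-NavierStokesRegularity-26889 --as helper`. [cite: NazarovUraltseva2011HarnackDivFree, §3 (arXiv:1011.1888 p. 8)]
-/

noncomputable section

-- the summit and its single sub-problem share the name (CONVENTIONS §1)
set_option linter.dupNamespace false

open MeasureTheory Set Function Filter Topology Metric
open scoped NNReal ENNReal InnerProductSpace RealInnerProductSpace

namespace Summit.NavierStokesRegularity.NavierStokesRegularity.Theorems.AveragedConeLiouville.NUPositivity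

/-! ### The divergence test at a Rademacher point -/

/-- **`⟪v, ∇ₓ(H(g)Θ²c)⟫ = c·(Θ²H′(V)⟪v,∇V⟫ + H(V)⟪v,∇Θ²⟫)` at a Rademacher point of `g` in `W`.** [folklore] -/
theorem inner_gradient_test_at {W : Set (ℝ × EuclideanSpace ℝ (Fin 3))} (hW : IsOpen W)
    {V : ℝ → EuclideanSpace ℝ (Fin 3) → ℝ} {g : ℝ × EuclideanSpace ℝ (Fin 3) → ℝ} {L : ℝ≥0}
    (hg : LipschitzWith L g) (hVg : EqOn (uncurry V) g W) {p : ℝ × EuclideanSpace ℝ (Fin 3)}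
    (hp : p ∈ W) (hgd : DifferentiableAt ℝ g p) {H : ℝ → ℝ} (hH : ContDiff ℝ 2 H)
    {Θ : EuclideanSpace ℝ (Fin 3) → ℝ} (hΘ : ContDiff ℝ 1 Θ) (c : ℝ → ℝ) (v : EuclideanSpace ℝ (Fin 3)) :
    ⟪v, gradient (fun y => H (g (p.1, y)) * (Θ y ^ 2 * c p.1)) p.2⟫ =
      c p.1 * (Θ p.2 ^ 2 * (deriv H (V p.1 p.2) * ⟪v, gradient (V p.1) p.2⟫)) +
        c p.1 * (H (V p.1 p.2) * ⟪v, gradient (fun y => Θ y ^ 2) p.2⟫) := by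
  obtain ⟨hgrad, -, -, -, -, -⟩ := slice_derivs_at hW hg hVg hp hgd
  have hVgp : V p.1 p.2 = g p := by have := hVg hp; simpa [uncurry] using this
  set Lx : EuclideanSpace ℝ (Fin 3) →L[ℝ] ℝ :=
    (fderiv ℝ g p).comp (ContinuousLinearMap.inr ℝ ℝ (EuclideanSpace ℝ (Fin 3))) with hLx
  have hsl : HasFDerivAt (fun y => g (p.1, y)) Lx p.2 := hasFDerivAt_slice_of_differentiableAt hgd
  have hHd : HasDerivAt H (deriv H (g p)) (g (p.1, p.2)) :=
    ((hH.differentiable (by norm_num)) _).hasDerivAt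
  have h1 : HasFDerivAt (fun y => H (g (p.1, y))) (deriv H (g p) • Lx) p.2 := hHd.comp_hasFDerivAt p.2 hsl
  have hΘ2 : ContDiff ℝ 1 fun y => Θ y ^ 2 := hΘ.pow 2
  have h2 : HasFDerivAt (fun y => Θ y ^ 2 * c p.1) (c p.1 • fderiv ℝ (fun y => Θ y ^ 2) p.2) p.2 :=
    ((hΘ2.differentiable one_ne_zero) p.2).hasFDerivAt.mul_const (c p.1)
  have h12 : HasFDerivAt (fun y => H (g (p.1, y)) * (Θ y ^ 2 * c p.1))
      (H (g (p.1, p.2)) • (c p.1 • fderiv ℝ (fun y => Θ y ^ 2) p.2) +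
        (Θ p.2 ^ 2 * c p.1) • (deriv H (g p) • Lx)) p.2 := h1.mul h2
  have hgr : gradient (fun y => H (g (p.1, y)) * (Θ y ^ 2 * c p.1)) p.2 =
      (InnerProductSpace.toDual ℝ (EuclideanSpace ℝ (Fin 3))).symm
        (H (g (p.1, p.2)) • (c p.1 • fderiv ℝ (fun y => Θ y ^ 2) p.2) +
          (Θ p.2 ^ 2 * c p.1) • (deriv H (g p) • Lx)) := by
    rw [gradient, h12.fderiv]
  have hinnV : ⟪v, gradient (V p.1) p.2⟫ = Lx v := by
    rw [hgrad, real_inner_comm, InnerProductSpace.toDual_symm_apply]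
  have hinnΘ : ⟪v, gradient (fun y => Θ y ^ 2) p.2⟫ = fderiv ℝ (fun y => Θ y ^ 2) p.2 v := by
    rw [gradient, real_inner_comm, InnerProductSpace.toDual_symm_apply]
  rw [hgr, real_inner_comm, InnerProductSpace.toDual_symm_apply, hinnV, hinnΘ, hVgp]
  simp only [add_apply, smul_apply, smul_eq_mul]
  have : g (p.1, p.2) = g p := rfl
  rw [this]
  ring

/-! ### The transfer on a time slab -/

set_option maxHeartbeats 1600000 in
/-- **The drift term transfers onto `Θ²`:** `∫∫_{[t₁,t₂]×ℝ³} η Θ² H′(V)⟪b,∇V⟫ + ∫∫_{[t₁,t₂]×ℝ³} η H(V)⟪b,∇Θ²⟫ = 0` for the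
weak data of the typed fact (the divergence-free clause tested against `H(V)Θ²ηχ_h`, `h → 0⁺`).
[cite: NazarovUraltseva2011HarnackDivFree, §3 (arXiv:1011.1888 p. 8)] -/
theorem nu_drift_transfer {T : ℝ} {V : ℝ → EuclideanSpace ℝ (Fin 3) → ℝ}
    {b : ℝ → EuclideanSpace ℝ (Fin 3) → EuclideanSpace ℝ (Fin 3)} {Λ : ℝ}
    (hbm : Measurable (uncurry b))
    (hbΛ : ∀ t ∈ Ioo 0 T, ∀ x ∈ ball (0 : EuclideanSpace ℝ (Fin 3)) 1, ‖b t x‖ ≤ Λ)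
    (hdiv : ∀ φ : ℝ → EuclideanSpace ℝ (Fin 3) → ℝ, ContDiff ℝ (⊤ : ℕ∞) (uncurry φ) →
        HasCompactSupport (uncurry φ) →
        tsupport (uncurry φ) ⊆ Ioo 0 T ×ˢ ball (0 : EuclideanSpace ℝ (Fin 3)) 1 →
        ∫ p in Ioo 0 T ×ˢ ball (0 : EuclideanSpace ℝ (Fin 3)) 1,
          inner ℝ (b p.1 p.2) (gradient (φ p.1) p.2) = 0)
    (hVlip : ∃ L, LipschitzOnWith L (uncurry V) (Ioo 0 T ×ˢ ball (0 : EuclideanSpace ℝ (Fin 3)) 1))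
    {H : ℝ → ℝ} (hH : ContDiff ℝ 2 H) {Θ : EuclideanSpace ℝ (Fin 3) → ℝ} (hΘ : ContDiff ℝ 1 Θ)
    (hΘc : HasCompactSupport Θ) {ρ₀ : ℝ} (hρ₀ : ρ₀ < 1)
    (hΘρ : tsupport Θ ⊆ ball (0 : EuclideanSpace ℝ (Fin 3)) ρ₀)
    {η : ℝ → ℝ} (hη : ContDiff ℝ 1 η) {t₁ t₂ : ℝ} (h0 : 0 < t₁) (h12 : t₁ ≤ t₂) (hT : t₂ < T) :
    (∫ z in Icc t₁ t₂ ×ˢ (univ : Set (EuclideanSpace ℝ (Fin 3))),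
        η z.1 * (Θ z.2 ^ 2 * (deriv H (V z.1 z.2) * ⟪b z.1 z.2, gradient (V z.1) z.2⟫))) +
      (∫ z in Icc t₁ t₂ ×ˢ (univ : Set (EuclideanSpace ℝ (Fin 3))),
        η z.1 * (H (V z.1 z.2) * ⟪b z.1 z.2, gradient (fun y => Θ y ^ 2) z.2⟫)) = 0 := by
  set W : Set (ℝ × EuclideanSpace ℝ (Fin 3)) := Ioo 0 T ×ˢ ball (0 : EuclideanSpace ℝ (Fin 3)) 1 with hWdef
  have hWo : IsOpen W := isOpen_Ioo.prod isOpen_ball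
  have hWm : MeasurableSet W := hWo.measurableSet
  have hWc : IsCompact (Icc 0 T ×ˢ closedBall (0 : EuclideanSpace ℝ (Fin 3)) 1) :=
    isCompact_Icc.prod (isCompact_closedBall _ _)
  have hWsub : W ⊆ Icc 0 T ×ˢ closedBall (0 : EuclideanSpace ℝ (Fin 3)) 1 :=
    Set.prod_mono Ioo_subset_Icc_self ball_subset_closedBall
  have hWfin : volume W < ∞ := (measure_mono hWsub).trans_lt hWc.measure_lt_top
  haveI : IsFiniteMeasure (volume.restrict W) := ⟨by rw [Measure.restrict_apply_univ]; exact hWfin⟩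
  haveI : (volume : Measure (ℝ × EuclideanSpace ℝ (Fin 3))).IsAddHaarMeasure := by
    rw [Measure.volume_eq_prod]; infer_instance
  -- the Lipschitz extension
  obtain ⟨L, hL⟩ := hVlip
  obtain ⟨g, hg, hVg⟩ := hL.extend_real
  have hVgp : ∀ p ∈ W, V p.1 p.2 = g p := fun p hp => by have := hVg hp; simpa [uncurry] using this
  have hae : ∀ᵐ p ∂(volume.restrict W), p ∈ W ∧ DifferentiableAt ℝ g p :=
    (ae_restrict_mem hWm).and (ae_restrict_of_ae (hg.ae_differentiableAt (μ := volume)))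
  -- `Θ` vanishes off `B(0,1)` and so does `∇Θ²`
  have hΘ2 : ContDiff ℝ 1 fun y => Θ y ^ 2 := hΘ.pow 2
  have hΘ2c : HasCompactSupport fun y => Θ y ^ 2 := by
    have e : (fun y => Θ y ^ 2) = fun y => Θ y * Θ y := funext fun y => pow_two _
    rw [e]; exact hΘc.mul_left
  have hΘ0 : ∀ x, x ∉ ball (0 : EuclideanSpace ℝ (Fin 3)) 1 → Θ x = 0 := fun x hx =>
    image_eq_zero_of_notMem_tsupport fun h => hx (ball_subset_ball hρ₀.le (hΘρ h))
  have hgradΘ0 : ∀ x, x ∉ ball (0 : EuclideanSpace ℝ (Fin 3)) 1 → gradient (fun y => Θ y ^ 2) x = 0 := by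
    intro x hx
    have hx' : x ∉ tsupport fun y => Θ y ^ 2 := by
      intro h
      have hsub : tsupport (fun y => Θ y ^ 2) ⊆ tsupport Θ := by
        have e : (fun y => Θ y ^ 2) = fun y => Θ y * Θ y := funext fun y => pow_two _
        rw [e]; exact tsupport_mul_subset_left
      exact hx (ball_subset_ball hρ₀.le (hΘρ (hsub h)))
    rw [gradient, fderiv_of_notMem_tsupport ℝ hx', map_zero]
  -- bounds
  obtain ⟨Mg, hMg⟩ := hWc.exists_bound_of_continuousOn hg.continuous.continuousOn
  obtain ⟨MH, hMH⟩ := isCompact_Icc.exists_bound_of_continuousOn (hH.continuous.continuousOn (s := Icc (-Mg) Mg))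
  have hgK : ∀ p ∈ W, g p ∈ Icc (-Mg) Mg := fun p hp =>
    abs_le.mp ((Real.norm_eq_abs _).symm.le.trans (hMg p (hWsub hp)))
  obtain ⟨Cη, hCη⟩ := isCompact_Icc.exists_bound_of_continuousOn (hη.continuous.continuousOn (s := Icc 0 T))
  obtain ⟨BΘ, hBΘ⟩ := (hΘ2c.fderiv (𝕜 := ℝ)).exists_bound_of_continuous (hΘ2.continuous_fderiv one_ne_zero)
  -- the two integrands
  set F₁ : ℝ × EuclideanSpace ℝ (Fin 3) → ℝ := fun z =>
    η z.1 * (Θ z.2 ^ 2 * (deriv H (V z.1 z.2) * ⟪b z.1 z.2, gradient (V z.1) z.2⟫)) with hF₁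
  set F₂ : ℝ × EuclideanSpace ℝ (Fin 3) → ℝ := fun z =>
    η z.1 * (H (V z.1 z.2) * ⟪b z.1 z.2, gradient (fun y => Θ y ^ 2) z.2⟫) with hF₂
  -- integrability on `W`
  have hF₁i : Integrable F₁ (volume.restrict W) := by
    obtain ⟨C, hC⟩ := nu_weak_pieces_bound hbΛ hg hVg hH hΘ hΘc hη.continuous
    have hm := (nu_weak_pieces_aesm (T := T) hbm hg hVg hH hΘ hη.continuous).2.2.2
    refine Integrable.mono' (integrable_const C) hm ?_
    filter_upwards [hae] with p hp
    rw [Real.norm_eq_abs]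
    exact (hC p hp.1 hp.2).2.2.2
  have hF₂i : Integrable F₂ (volume.restrict W) := by
    have hm : AEStronglyMeasurable F₂ (volume.restrict W) := by
      have hmod : AEStronglyMeasurable (fun z : ℝ × EuclideanSpace ℝ (Fin 3) =>
          η z.1 * (H (g z) * ⟪b z.1 z.2, gradient (fun y => Θ y ^ 2) z.2⟫)) (volume.restrict W) := by
        have hgr : Continuous fun z : ℝ × EuclideanSpace ℝ (Fin 3) => gradient (fun y => Θ y ^ 2) z.2 := by
          have : Continuous (gradient fun y => Θ y ^ 2) := by
            have e : gradient (fun y => Θ y ^ 2) = fun x =>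
                (InnerProductSpace.toDual ℝ (EuclideanSpace ℝ (Fin 3))).symm (fderiv ℝ (fun y => Θ y ^ 2) x) := rfl
            rw [e]
            exact (InnerProductSpace.toDual ℝ (EuclideanSpace ℝ (Fin 3))).symm.continuous.comp
              (hΘ2.continuous_fderiv one_ne_zero)
          exact this.comp continuous_snd
        exact (((hη.continuous.comp continuous_fst).aestronglyMeasurable).mul
          (((hH.continuous.comp hg.continuous).aestronglyMeasurable).mul
            (hbm.aestronglyMeasurable.inner hgr.aestronglyMeasurable))).restrict
      refine hmod.congr ?_
      filter_upwards [ae_restrict_mem hWm] with p hp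
      simp only [hF₂, hVgp p hp]
    refine Integrable.mono' (integrable_const (Cη * (MH * (Λ * BΘ)))) hm ?_
    filter_upwards [ae_restrict_mem hWm] with p hp
    have hp' : p.1 ∈ Ioo 0 T ∧ p.2 ∈ ball (0 : EuclideanSpace ℝ (Fin 3)) 1 := by
      rw [hWdef, mem_prod] at hp; exact hp
    rw [hF₂]
    dsimp only
    rw [norm_mul, norm_mul, hVgp p hp]
    have h1 : ‖η p.1‖ ≤ Cη := hCη p.1 (Ioo_subset_Icc_self hp'.1)
    have h2 : ‖H (g p)‖ ≤ MH := hMH _ (hgK p hp)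
    have h3 : ‖⟪b p.1 p.2, gradient (fun y => Θ y ^ 2) p.2⟫‖ ≤ Λ * BΘ := by
      refine (norm_inner_le_norm _ _).trans (mul_le_mul (hbΛ p.1 hp'.1 p.2 hp'.2) ?_ (norm_nonneg _)
        ((norm_nonneg _).trans (hbΛ p.1 hp'.1 p.2 hp'.2)))
      rw [gradient, LinearIsometryEquiv.norm_map]
      exact hBΘ p.2
    have hCη0 : 0 ≤ Cη := (norm_nonneg _).trans h1
    have hMH0 : 0 ≤ MH := (norm_nonneg _).trans h2
    exact mul_le_mul h1 (mul_le_mul h2 h3 (norm_nonneg _) hMH0) (mul_nonneg (norm_nonneg _) (norm_nonneg _)) hCη0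
  -- the plateau family `χ_h`
  set χf : ℝ → ℝ → ℝ := fun h => if hh : 0 < h then Classical.choose (exists_slab_cutoff h12 hh) else fun _ => 0
    with hχf
  have hχspec : ∀ h (hh : 0 < h), LipschitzWith (Real.toNNReal h⁻¹) (χf h) ∧ (∀ t, 0 ≤ χf h t ∧ χf h t ≤ 1) ∧
      (∀ t, t ≤ t₁ - h → χf h t = 0) ∧ (∀ t, t₂ + h ≤ t → χf h t = 0) ∧ (∀ t ∈ Icc t₁ t₂, χf h t = 1) := by
    intro h hh
    have e : χf h = Classical.choose (exists_slab_cutoff h12 hh) := by rw [hχf]; exact dif_pos hh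
    obtain ⟨h1, h2, h3, h4, h5, -⟩ := Classical.choose_spec (exists_slab_cutoff h12 hh)
    rw [e]
    exact ⟨h1, h2, h3, h4, h5⟩
  -- ### the divergence test for small `h`
  set h₀ : ℝ := min t₁ (T - t₂) / 2 with hh₀
  have hh₀pos : 0 < h₀ := by rw [hh₀]; exact div_pos (lt_min h0 (by linarith)) two_pos
  have key : ∀ h, 0 < h → h < h₀ → ∫ p in W, χf h p.1 * (F₁ p + F₂ p) = 0 := by
    intro h hh hhh₀
    have hmin1 : h₀ ≤ t₁ / 2 := by
      rw [hh₀]; exact div_le_div_of_nonneg_right (min_le_left _ _) two_pos.le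
    have hmin2 : h₀ ≤ (T - t₂) / 2 := by
      rw [hh₀]; exact div_le_div_of_nonneg_right (min_le_right _ _) two_pos.le
    have ha : 0 < t₁ - h := by linarith
    have hb : t₂ + h < T := by linarith
    obtain ⟨hχl, hχb, hχa, hχb', -⟩ := hχspec h hh
    -- the Lipschitz slab weight `c = η χ_h`
    obtain ⟨Kc, hc⟩ := exists_lipschitzWith_slab_weight hη hχl hχb hχa hχb'
    set c : ℝ → ℝ := fun t => η t * χf h t with hcdef
    have hcτ : ∀ t, t ≤ t₁ - h → c t = 0 := fun t ht => by simp [hcdef, hχa t ht]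
    have hcT : ∀ t, t₂ + h ≤ t → c t = 0 := fun t ht => by simp [hcdef, hχb' t ht]
    -- the test `w = H(g) Θ² c`
    set w : ℝ → EuclideanSpace ℝ (Fin 3) → ℝ := fun t x => H (g (t, x)) * (Θ x ^ 2 * c t) with hwdef
    have hH1 : ContDiff ℝ 1 fun v => -H v := hH.neg.of_le (by norm_num)
    obtain ⟨Kw, hKw⟩ := exists_lipschitzWith_test hg hH1 hΘ hΘc hΘρ hc hcτ hcT
    have hw : LipschitzWith Kw (uncurry w) := by
      have e : (uncurry fun t x => -(fun v => -H v) (g (t, x)) * (Θ x ^ 2 * c t)) = uncurry w := by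
        funext p; simp [hwdef, uncurry]
      rw [← e]; exact hKw
    set K : Set (ℝ × EuclideanSpace ℝ (Fin 3)) := Icc (t₁ - h) (t₂ + h) ×ˢ closedBall (0 : EuclideanSpace ℝ (Fin 3)) ρ₀
      with hKdef
    have hKc : IsCompact K := isCompact_Icc.prod (isCompact_closedBall _ _)
    have hwK : ∀ p, p ∉ K → uncurry w p = 0 := by
      intro p hp
      rw [hKdef, mem_prod, not_and_or] at hp
      show H (g (p.1, p.2)) * (Θ p.2 ^ 2 * c p.1) = 0
      rcases hp with hp | hp
      · have : c p.1 = 0 := by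
          rcases not_and_or.mp (show ¬ (t₁ - h ≤ p.1 ∧ p.1 ≤ t₂ + h) from hp) with h' | h'
          · exact hcτ p.1 (le_of_lt (not_le.mp h'))
          · exact hcT p.1 (le_of_lt (not_le.mp h'))
        rw [this]; ring
      · have : Θ p.2 = 0 := image_eq_zero_of_notMem_tsupport fun h' =>
          hp (ball_subset_closedBall (hΘρ h'))
        rw [this]; ring
    have hwc : HasCompactSupport (uncurry w) := HasCompactSupport.intro hKc hwK
    have hKW : K ⊆ W := Set.prod_mono (fun t ht => ⟨ha.trans_le ht.1, ht.2.trans_lt hb⟩) (closedBall_subset_ball hρ₀)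
    have hws : tsupport (uncurry w) ⊆ W :=
      (closure_minimal (fun p hp => by by_contra h'; exact hp (hwK p h')) hKc.isClosed).trans hKW
    have h0int := NU.integral_inner_gradient_eq_zero_of_lipschitz hbm hbΛ hdiv hw hwc hws
    rw [← h0int]
    refine integral_congr_ae ?_
    filter_upwards [hae] with p hp
    have e := inner_gradient_test_at hWo hg hVg hp.1 hp.2 hH hΘ c (b p.1 p.2)
    show χf h p.1 * (F₁ p + F₂ p) = ⟪b p.1 p.2, gradient (w p.1) p.2⟫
    rw [show (w p.1) = fun y => H (g (p.1, y)) * (Θ y ^ 2 * c p.1) from rfl, e, hF₁, hF₂, hcdef]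
    ring
  -- ### `h → 0⁺`
  have hlim : Tendsto (fun h => ∫ p in W, χf h p.1 * (F₁ p + F₂ p)) (𝓝[>] 0)
      (𝓝 (∫ p in W, (Icc t₁ t₂).indicator 1 p.1 * (F₁ p + F₂ p))) := by
    refine tendsto_integral_cutoff (hF₁i.add hF₂i) (fun h hh => (hχspec h hh).1.continuous)
      (fun h hh t => ?_) (tendsto_slab_cutoff_indicator (fun h hh => (hχspec h hh).2.2.2.2)
        (fun h hh => (hχspec h hh).2.2.1) (fun h hh => (hχspec h hh).2.2.2.1))
    rw [abs_of_nonneg ((hχspec h hh).2.1 t).1]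
    exact ((hχspec h hh).2.1 t).2
  have hlim0 : Tendsto (fun h => ∫ p in W, χf h p.1 * (F₁ p + F₂ p)) (𝓝[>] 0) (𝓝 0) := by
    refine tendsto_const_nhds.congr' ?_
    have hev : ∀ᶠ h in 𝓝[>] (0 : ℝ), h ∈ Ioo 0 h₀ := Ioo_mem_nhdsGT hh₀pos
    filter_upwards [hev] with h hh
    exact (key h hh.1 hh.2).symm
  have hcut : ∫ p in W, (Icc t₁ t₂).indicator 1 p.1 * (F₁ p + F₂ p) = 0 := tendsto_nhds_unique hlim hlim0
  -- ### back to `[t₁,t₂] × ℝ³`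
  have hI : Measurable fun p : ℝ × EuclideanSpace ℝ (Fin 3) => (Icc t₁ t₂).indicator (1 : ℝ → ℝ) p.1 :=
    (measurable_const.indicator measurableSet_Icc).comp measurable_fst
  have hIb : ∀ p : ℝ × EuclideanSpace ℝ (Fin 3), ‖(Icc t₁ t₂).indicator (1 : ℝ → ℝ) p.1‖ ≤ 1 := fun p => by
    by_cases hp : p.1 ∈ Icc t₁ t₂
    · rw [indicator_of_mem hp]; simp
    · rw [indicator_of_notMem hp]; simp
  have hi₁ : Integrable (fun p => (Icc t₁ t₂).indicator (1 : ℝ → ℝ) p.1 * F₁ p) (volume.restrict W) :=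
    hF₁i.bdd_mul hI.aestronglyMeasurable (Eventually.of_forall hIb)
  have hi₂ : Integrable (fun p => (Icc t₁ t₂).indicator (1 : ℝ → ℝ) p.1 * F₂ p) (volume.restrict W) :=
    hF₂i.bdd_mul hI.aestronglyMeasurable (Eventually.of_forall hIb)
  have hsplit : ∫ p in W, (Icc t₁ t₂).indicator 1 p.1 * (F₁ p + F₂ p) =
      (∫ p in W, (Icc t₁ t₂).indicator 1 p.1 * F₁ p) + ∫ p in W, (Icc t₁ t₂).indicator 1 p.1 * F₂ p := by
    rw [← integral_add hi₁ hi₂]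
    refine integral_congr_ae (Eventually.of_forall fun p => ?_)
    simp only [mul_add]
  have e₁ := setIntegral_Icc_univ_eq_cutoff h0 hT (F := F₁) fun p hp => by
    simp only [hF₁, hΘ0 p.2 hp]; ring
  have e₂ := setIntegral_Icc_univ_eq_cutoff h0 hT (F := F₂) fun p hp => by
    simp only [hF₂, hgradΘ0 p.2 hp, inner_zero_right]; ring
  rw [e₁, e₂, ← hsplit]
  exact hcut

end Summit.NavierStokesRegularity.NavierStokesRegularity.Theorems.AveragedConeLiouville.NUPositivity

end
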